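import Mathlib
import HarnessLib
import Summits.HubbardSuperconductivity.HubbardSuperconductivity.Theorems.KLProgrammePerturbedCountDefs

/-!
# Route `KLProgramme` — crux K1 `H10TwoPointLimit` (stmt-HubbardSuperconductivity-19938):
# the sector-counting level function on the PERTURBED curve — first derivatives (pure calculus)

First port step of HOME/prover-p4/PORT-NOTE.md (architecture (β), GAP-LEDGER G-002 closer (i)) over the vocabulary of
`KLProgrammePerturbedCountDefs.lean` (`XE/YE/VXE/VYE/SXE/SYE/momE/hfunE/h3E`), the part that needs no hypothesis on the curve:
`hasDerivAt_XE/YE` (velocity of the polar curve of any differentiable radius function), `hasDerivAt_momE_three`,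
**`hasDerivAt_hfunE_three`** (`∂₃ h^E = h3E`, the analogue of the tree's `hasDerivAt_hfun_three`; chain rule with `∇E = ∇ε₀ + Dδ`) and
`hasDerivAt_hfunE_two` by symmetry. The band coordinates of the perturbed curve at the SHIFTED level (which need the regularity file
`…PerturbedFermiRadiusSmooth`) are in `KLProgrammeH10TwoPointLimitPerturbedCountDeriv.lean`.
Everything is PROVED; no definitions. References: BGM 2006 App. A2 (A2.8) [cite: BenfattoGiulianiMastropietro2006].
-/

noncomputable section

namespace Summit.HubbardSuperconductivity.HubbardSuperconductivity.Theorems.PerturbedFermiCurve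

set_option linter.dupNamespace false -- summit = problem name (single-conjunct summit), D-0017

open Real Set
open Literature.MathematicalPhysics.QuantumLattice Literature.MathematicalPhysics.QuantumLattice.BandSectorCounting

/-! ## §1 First derivatives of the perturbed level function -/

/-- Velocity of the polar curve, first coordinate: `(d/dθ)(u cos θ) = u' cos θ - u sin θ`. [folklore] -/
theorem hasDerivAt_XE {u : ℝ → ℝ} {θ : ℝ} (hu : DifferentiableAt ℝ u θ) : HasDerivAt (XE u) (VXE u θ) θ := by
  have h := hu.hasDerivAt.mul (Real.hasDerivAt_cos θ)
  refine h.congr_deriv ?_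
  simp [VXE]; ring

/-- Velocity of the polar curve, second coordinate: `(d/dθ)(u sin θ) = u' sin θ + u cos θ`. [folklore] -/
theorem hasDerivAt_YE {u : ℝ → ℝ} {θ : ℝ} (hu : DifferentiableAt ℝ u θ) : HasDerivAt (YE u) (VYE u θ) θ := by
  have h := hu.hasDerivAt.mul (Real.hasDerivAt_sin θ)
  refine h.congr_deriv ?_
  simp [VYE]

/-- The momentum sum as a function of `θ₃` has derivative `p_E'(θ₃) = (X_E', Y_E')(θ₃)`. [folklore] -/
theorem hasDerivAt_momE_three {u : ℝ → ℝ} (P : ℝ × ℝ) (θ₂ : ℝ) {θ₃ : ℝ} (hu : DifferentiableAt ℝ u θ₃) :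
    HasDerivAt (fun x => momE u P θ₂ x) ![VXE u θ₃, VYE u θ₃] θ₃ := by
  refine hasDerivAt_pi.2 fun i => ?_
  fin_cases i
  · simpa [momE, SXE] using (hasDerivAt_XE hu).const_add (P.1 + XE u θ₂)
  · simpa [momE, SYE] using (hasDerivAt_YE hu).const_add (P.2 + YE u θ₂)

/-- **`∂₃ h^E = h3E`**: the derivative of the perturbed offset level function in the third angle (the tree's `hasDerivAt_hfun_three`
on the perturbed curve; chain rule with `∇E = ∇ε₀ + Dδ`). [cite: BenfattoGiulianiMastropietro2006, App. A2 (A2.8)] -/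
theorem hasDerivAt_hfunE_three {δ : (Fin 2 → ℝ) → ℝ} {u : ℝ → ℝ} (μ : ℝ) (P : ℝ × ℝ) (θ₂ : ℝ) {θ₃ : ℝ}
    (hu : DifferentiableAt ℝ u θ₃) (hδ : DifferentiableAt ℝ δ (momE u P θ₂ θ₃)) :
    HasDerivAt (fun x => hfunE δ u μ P θ₂ x) (h3E δ u P θ₂ θ₃) θ₃ := by
  have hX : HasDerivAt (fun x => SXE u P θ₂ x) (VXE u θ₃) θ₃ := by
    unfold SXE; exact (hasDerivAt_XE hu).const_add _
  have hY : HasDerivAt (fun x => SYE u P θ₂ x) (VYE u θ₃) θ₃ := by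
    unfold SYE; exact (hasDerivAt_YE hu).const_add _
  have hfree : HasDerivAt (fun x => eps2 (SXE u P θ₂ x) (SYE u P θ₂ x))
      (2 * Real.sin (SXE u P θ₂ θ₃) * VXE u θ₃ + 2 * Real.sin (SYE u P θ₂ θ₃) * VYE u θ₃) θ₃ := by
    have h := (hX.cos.add hY.cos).const_mul (-2)
    unfold eps2
    exact h.congr_deriv (by ring)
  have hpert : HasDerivAt (fun x => δ (momE u P θ₂ x)) (fderiv ℝ δ (momE u P θ₂ θ₃) ![VXE u θ₃, VYE u θ₃]) θ₃ :=
    hδ.hasFDerivAt.comp_hasDerivAt θ₃ (hasDerivAt_momE_three P θ₂ hu)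
  have h := (hfree.add hpert).sub_const μ
  unfold hfunE h3E
  exact h

/-- `∂₂ h^E(θ₂, θ₃) = h3E(θ₃, θ₂)` (symmetry `h^E(θ₂, θ₃) = h^E(θ₃, θ₂)`). [folklore] -/
theorem hasDerivAt_hfunE_two {δ : (Fin 2 → ℝ) → ℝ} {u : ℝ → ℝ} (μ : ℝ) (P : ℝ × ℝ) {θ₂ : ℝ} (θ₃ : ℝ)
    (hu : DifferentiableAt ℝ u θ₂) (hδ : DifferentiableAt ℝ δ (momE u P θ₃ θ₂)) :
    HasDerivAt (fun x => hfunE δ u μ P x θ₃) (h3E δ u P θ₃ θ₂) θ₂ := by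
  have h := hasDerivAt_hfunE_three μ P θ₃ hu hδ
  refine h.congr_of_eventuallyEq (Filter.Eventually.of_forall fun x => ?_)
  exact hfunE_swap δ u μ P x θ₃

end Summit.HubbardSuperconductivity.HubbardSuperconductivity.Theorems.PerturbedFermiCurve

end
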